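import Summits.FinalStateConjecture.FinalStateConjecture.Theses.StarvedNecks
import Literature.Geometry.Lorentzian.CausalityPushUp

/-!
# Route StarvedNecks — crux `NecksCertify`, line `two-cap-focusing-ledger`: seam surgery, `N = 0`

Helper for the registered stub `stub_seamSurgery` (N2) of the line skeleton: the case of an input
decomposition WITHOUT black holes (`d.N = 0`).  Then the atlas `NeckAtlas`, clauses (1)–(3) of
`HonestCore` and ten of the twelve clauses of `Seamed` are vacuous, and the seamed `C²`
decomposition `d₂` is the input restricted to a later starting time `T` (same flat domain, same
flat chart, no hole chart):

* `T > τ₁ (≥ τ₀)` and so late that the flat `C⁴` slab deviation is `≤ 1/10` from `T` on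
  (`tendsto_deviationCk_flat`), which is clause S3 of `Seamed` (a `C⁰` sup over the union of the
  late slabs);
* the flat chart is a late chart after `T` by the rung `SeamFlatRestrict` (an antecedent of the
  stub) applied to `U' = U`;
* the covering clause of `d₂` is clause A13 of the atlas at the threshold `T` (for `N = 0` its hole
  parts are empty and its compatibility premise is vacuous);
* `O = exteriorOf 𝒟 d₂.charted`: `⊇` by monotonicity of `I⁻`; `⊆` because a point of `O` is
  chronologically below a flat-late point `Φ y`, which is either `T`-late or, by `HonestFar` (1),
  causally below the flat slab `{y⁰ = T + 1}`, and push-up (`x ≪ y ≤ z ⇒ x ≪ z`, O'Neill 1983,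
  Cor. 14.1, `mem_chronologicalFuture_of_mem_causalFuture` for the reversed time orientation);
* `HonestCore`(4) of `d₂` is `HonestCore`(4) of `d`; S11 of `Seamed` is `HonestFar`(2).

The statement is the registered signature of `stub_seamSurgery` with the six bundles of the line
skeleton (`HonestCore`, `HonestFar`, `Seamed`, `NeckAtlas`, `SeamFlatRestrict`, `SeamClockRadii`)
inlined verbatim as `let`s and ONE extra antecedent `d.N = 0` inserted after `HonestFar … →`.

References: B. O'Neill, *Semi-Riemannian geometry*, Academic Press 1983, Ch. 14, Cor. 14.1 and
p. 403; M. Dafermos, G. Holzegel, I. Rodnianski, M. Taylor, arXiv:2104.08222, §1 (late-time charts).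
Mathlib + `Literature.Geometry.Lorentzian.{KerrConvergence, FinalState, CausalityPushUp}`; no
definitions, no named facts.
-/

noncomputable section

open scoped Manifold ContDiff Topology ENNReal
open Filter Set MeasureTheory Topology Literature.Geometry.Lorentzian

namespace Summit.FinalStateConjecture.FinalStateConjecture.Theorems.NecksCertifyTwoCap.Seam

set_option linter.dupNamespace false

/-- Registered helper sub-goal `stub_seamSurgery_flatLateSup` of the seam stub N2 (clause S3 of
`Seamed` from slab-wise control): if every flat slab `{y⁰ = τ}`, `τ ≥ T`, of a chart `Φ` on the
Minkowski background over `U` has `Cᵏ` deviation `≤ ε`, then the `C⁰` sup norm of the extended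
deviation over the whole late part `{y ∈ U | T ≤ y⁰}` is `≤ ε` (the late part is the union of the
late slabs; `supCkENorm` is a double supremum).  DHRT arXiv:2104.08222, §1. [folklore] -/
theorem stub_seamSurgery_flatLateSup :
    ∀ (𝓢 : Spacetime.{0} 4) (U : TopologicalSpace.Opens E4) (Φ : U → 𝓢.carrier) (k : ℕ) (T : ℝ)
      (ε : ℝ≥0∞), (∀ τ, T ≤ τ → 𝓢.deviationCk (Minkowski.backgroundOn U) Φ k τ ≤ ε) →
      supCkENorm (Subtype.val '' {y : U | T ≤ y.1 0}) 0
        (𝓢.deviationExtend (Minkowski.backgroundOn U) Φ) ≤ ε := by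
  intro 𝓢 U Φ k T ε h
  refine iSup₂_le fun m hm ↦ iSup₂_le fun x hx ↦ ?_
  obtain ⟨y, hy, rfl⟩ := hx
  have hy' : T ≤ y.1 0 := hy
  exact (enorm_iteratedFDeriv_le_supCkENorm (hm.trans (Nat.zero_le k))
    (Set.mem_image_of_mem Subtype.val
      (show y ∈ (Minkowski.backgroundOn U).timeSlab (y.1 0) from rfl)) _).trans (h _ hy')

/-- **Seam surgery without black holes.**  The registered stub `stub_seamSurgery` (N2:
`SeamClockRadii → SeamFlatRestrict → ∀ … NeckAtlas … → ∃ d₂ R R₀', O = exteriorOf 𝒟 d₂.charted ∧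
HonestCore d₂ R₀' ∧ Seamed d₂ R R₀'`, bundles inlined) under the extra antecedent `d.N = 0`: the
witness is the input restricted to a late time `T` (flat `C⁰` deviation `≤ 1/10` from `T` on,
`T > τ₁`), with no hole chart; covering by A13, exterior equality by `HonestFar`(1) and push-up.
DHRT arXiv:2104.08222, §1; O'Neill 1983, Ch. 14, Cor. 14.1. [folklore] -/
theorem seamSurgery_of_N_eq_zero :
    let HonestCore := fun (𝓢 : Spacetime.{0} 4) (O : Set 𝓢.carrier) (k : ℕ)
        (d : FinalStateDecomposition 𝓢 O k) (R₀ : ℝ) ↦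
      let B := d.background; let t := fun i ↦ (B i).time; let r := fun i ↦ (B i).radius; let Ψ := d.chart;
      (∀ i, Kerr.IsSubextremal (d.mass i) (d.spin i) ∧ 100 * d.mass i ≤ R₀ ∧ 0 < ((d.motion i).1 : E4 ≃L[ℝ] E4) (E4.basisVector 0) 0) ∧
        (∀ i (ϱ τ₂ : ℝ), R₀ ≤ ϱ → d.τ₀ < τ₂ → Ψ i '' {x | d.τ₀ < t i x.1 ∧ t i x.1 < τ₂ ∧ r i x.1 < ϱ} ⊆ 𝓢.metric.causalPast 𝓢.timeOrientation (Ψ i '' (B i).truncTimeSlab ϱ τ₂)) ∧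
        (∀ i (τ' : ℝ) (ϱ : ℝ → ℝ), Continuous ϱ → d.τ₀ < τ' → let A := Ψ i '' {x | τ' ≤ t i x.1 ∧ r i x.1 ≤ ϱ (t i x.1)}; closure A ∩ O ⊆ A) ∧
        (∀ y : d.flatDomain, d.τ₀ < y.1 0 → 𝓢.timeOrientation.IsFutureDirected (mfderiv 𝓘(ℝ, E4) (𝓡 4) d.flatChart y (E4.basisVector 0)))
    let HonestFar := fun (𝓢 : Spacetime.{0} 4) (O : Set 𝓢.carrier) (k : ℕ)
        (d : FinalStateDecomposition 𝓢 O k) (R₀ : ℝ) ↦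
      let B := d.background; let t := fun i ↦ (B i).time; let r := fun i ↦ (B i).radius; let Φ := d.flatChart;
      (∀ τ₂ : ℝ, d.τ₀ < τ₂ → Φ '' {y | d.τ₀ < y.1 0 ∧ y.1 0 < τ₂} ⊆ 𝓢.metric.causalPast 𝓢.timeOrientation (Φ '' (Minkowski.backgroundOn d.flatDomain).timeSlab τ₂)) ∧
        (∀ τ' : ℝ, d.τ₀ < τ' → closure (Φ '' {y | τ' ≤ y.1 0 ∧ ∀ i, d.excision i (y.1 0) + 1 ≤ r i y.1}) ⊆ Φ '' {y | τ' ≤ y.1 0}) ∧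
        (∀ i, ∃ T : ℝ, supCkENorm (Subtype.val '' {x : (B i).domain | T ≤ t i x.1 ∧ R₀ ≤ r i x.1 ∧ ∀ j, j ≠ i → r i x.1 ≤ r j x.1}) 0 (𝓢.deviationExtend (B i) (d.chart i)) ≤ ENNReal.ofReal (1 / (10 * ‖(((d.motion i).1 : E4 ≃L[ℝ] E4) : E4 →L[ℝ] E4)‖ ^ 2)))
    let Seamed := fun (𝓢 : Spacetime.{0} 4) (O : Set 𝓢.carrier) (d : FinalStateDecomposition 𝓢 O 2)
        (R : Fin d.N → ℝ → ℝ) (R₀ : ℝ) ↦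
      let B := d.background; let t := fun i ↦ (B i).time; let r := fun i ↦ (B i).radius; let Λ := fun i ↦ ((d.motion i).1 : E4 ≃L[ℝ] E4); let Φ := d.flatChart; let Ψ := d.chart; let ρ := d.excision;
      (∀ i, Monotone (R i) ∧ Continuous (R i) ∧ ∀ s, R₀ + 4 ≤ R i s ∧ R₀ ≤ ρ i s) ∧
        (∀ i, Tendsto (fun τ ↦ 𝓢.truncDeviationCk (B i) (Ψ i) 2 (R i τ) τ) atTop (𝓝 0)) ∧
        supCkENorm (Subtype.val '' {y : d.flatDomain | d.τ₀ ≤ y.1 0}) 0 (𝓢.deviationExtend (Minkowski.backgroundOn d.flatDomain) Φ) ≤ 10⁻¹ ∧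
        (∀ i, supCkENorm (Subtype.val '' {x : (B i).domain | (d.τ₀ ≤ t i x.1 ∨ d.τ₀ ≤ x.1 0) ∧ R₀ ≤ r i x.1 ∧ r i x.1 ≤ R i (t i x.1)}) 0 (𝓢.deviationExtend (B i) (Ψ i)) ≤ ENNReal.ofReal (1 / (10 * ‖(Λ i : E4 →L[ℝ] E4)‖ ^ 2))) ∧
        (∀ i (x : (B i).domain), (d.τ₀ ≤ t i x.1 ∨ d.τ₀ ≤ x.1 0) → R₀ ≤ r i x.1 → r i x.1 ≤ R i (t i x.1) → 𝓢.timeOrientation.IsFutureDirected (mfderiv 𝓘(ℝ, E4) (𝓡 4) (Ψ i) x ((Λ i) (E4.basisVector 0)))) ∧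
        (∀ i (y : E4) (hy : y ∈ (B i).domain), d.τ₀ ≤ y 0 → (∀ j, ρ j (y 0) < r j y) → r i y ≤ R i (t i y) + 1 → ∃ hy' : y ∈ d.flatDomain, Ψ i ⟨y, hy⟩ = Φ ⟨y, hy'⟩) ∧
        (∀ y : d.flatDomain, d.τ₀ ≤ y.1 0 → ∀ j, ρ j (y.1 0) < r j y.1) ∧
        (∀ j (y : E4), d.τ₀ ≤ y 0 → r j y ≤ ρ j (y 0) → r j y + 2 ≤ R j (t j y)) ∧
        (∀ j (y : E4), d.τ₀ ≤ t j y → r j y ≤ R j (t j y) + 2 → t j y ≤ y 0) ∧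
        (∀ j, Ψ j '' {x | d.τ₀ < t j x.1 ∧ R j (t j x.1) + 1 < r j x.1} ⊆ d.radiationZone) ∧
        (∀ τ' : ℝ, d.τ₀ < τ' → closure (Φ '' {y | τ' ≤ y.1 0}) ⊆ Φ '' {y | τ' ≤ y.1 0} ∪ ⋃ j, Ψ j '' {x | τ' ≤ x.1 0 ∧ r j x.1 = ρ j (x.1 0)}) ∧
        (∀ j j' (y : E4), j ≠ j' → (d.τ₀ ≤ y 0 ∨ d.τ₀ ≤ t j y) → r j y ≤ R j (t j y) + 1 → R j' (t j' y) + 1 < r j' y)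
    let NeckAtlas := fun (𝓢 : Spacetime.{0} 4) (O : Set 𝓢.carrier) (d : FinalStateDecomposition 𝓢 O 4)
        (R₀ : ℝ) ↦
      let B := d.background; let t := fun i ↦ (B i).time; let r := fun i ↦ (B i).radius
      let Λ := fun i ↦ ((d.motion i).1 : E4 ≃L[ℝ] E4); let Φ := d.flatChart; let Ψ := d.chart
      let ρ := d.excision
      ∃ (R₁ τ₁ : ℝ) (ρ' Rg : Fin d.N → ℝ → ℝ) (Ψ' : ∀ i, (B i).domain → 𝓢.carrier),
        R₀ ≤ R₁ ∧ d.τ₀ ≤ τ₁ ∧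
        (∀ i, Continuous (ρ' i) ∧ Tendsto (fun s ↦ ρ' i s / s) atTop (𝓝 0) ∧
          ∀ s, R₁ + 1 ≤ ρ' i s ∧ (τ₁ ≤ s → ρ i s + 1 ≤ ρ' i s)) ∧
        (∀ i, Monotone (Rg i) ∧ Continuous (Rg i) ∧ Tendsto (fun s ↦ Rg i s / s) atTop (𝓝 0) ∧
          ∀ s, R₁ + 4 ≤ Rg i s) ∧
        (∀ j (y : E4), τ₁ ≤ y 0 → r j y ≤ ρ' j (y 0) → r j y + 3 ≤ Rg j (t j y)) ∧
        (∀ i, let U : Set (B i).domain := {x | τ₁ < t i x.1 ∧ r i x.1 < Rg i (t i x.1) + 2}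
          ContMDiffOn 𝓘(ℝ, E4) (𝓡 4) ∞ (Ψ' i) U ∧ IsOpenEmbedding (U.restrict (Ψ' i)) ∧
            Ψ' i '' U ⊆ d.charted) ∧
        (∀ i (x : (B i).domain), r i x.1 ≤ R₁ + 1 → Ψ' i x = Ψ i x) ∧
        (∀ i (y : E4) (hy : y ∈ (B i).domain), τ₁ ≤ y 0 → (∀ j, ρ' j (y 0) < r j y) →
          r i y ≤ Rg i (t i y) + 2 → ∃ hy' : y ∈ d.flatDomain, Ψ' i ⟨y, hy⟩ = Φ ⟨y, hy'⟩) ∧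
        (∀ i, Tendsto (fun τ ↦ 𝓢.truncDeviationCk (B i) (Ψ' i) 2 (Rg i τ) τ) atTop (𝓝 0)) ∧
        (∀ i, supCkENorm (Subtype.val '' {x : (B i).domain | τ₁ ≤ t i x.1 ∧ R₁ ≤ r i x.1 ∧
            r i x.1 ≤ Rg i (t i x.1) + 2}) 0 (𝓢.deviationExtend (B i) (Ψ' i)) ≤
          ENNReal.ofReal (1 / (10 * ‖(Λ i : E4 →L[ℝ] E4)‖ ^ 2))) ∧
        (∀ i (x : (B i).domain), τ₁ ≤ t i x.1 → R₁ ≤ r i x.1 → r i x.1 ≤ Rg i (t i x.1) + 2 →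
          𝓢.timeOrientation.IsFutureDirected
            (mfderiv 𝓘(ℝ, E4) (𝓡 4) (Ψ' i) x ((Λ i) (E4.basisVector 0)))) ∧
        (∀ i, Tendsto (Rg i) atTop atTop) ∧
        (∀ j j' (y : E4), j ≠ j' → τ₁ ≤ y 0 → r j y ≤ Rg j (t j y) + 2 → Rg j' (t j' y) + 2 < r j' y) ∧
        (∀ i j, i ≠ j → Disjoint (Ψ' i '' {x | τ₁ < t i x.1 ∧ r i x.1 < Rg i (t i x.1) + 2})
          (Ψ' j '' {x | τ₁ < t j x.1 ∧ r j x.1 < Rg j (t j x.1) + 2})) ∧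
        (∀ i (τ' : ℝ) (ϱ : ℝ → ℝ), Continuous ϱ → τ₁ < τ' → (∀ s, ϱ s < Rg i s + 2) →
          closure (Ψ' i '' {x | τ' ≤ t i x.1 ∧ r i x.1 ≤ ϱ (t i x.1)}) ∩ O ⊆
            Ψ' i '' {x | τ' ≤ t i x.1 ∧ r i x.1 ≤ ϱ (t i x.1)}) ∧
        (∀ (T : ℝ) (Th : Fin d.N → ℝ), τ₁ < T → (∀ j, τ₁ < Th j) →
          (∀ j (y : E4), T < y 0 → r j y ≤ Rg j (t j y) + 2 → Th j < t j y) →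
          O \ (Φ '' {y | T < y.1 0 ∧ ∀ j, ρ' j (y.1 0) < r j y.1} ∪
              ⋃ j, Ψ' j '' {x | Th j < t j x.1 ∧ r j x.1 < Rg j (t j x.1) + 2}) ⊆
            𝓢.metric.causalPast 𝓢.timeOrientation
              (Φ '' {y | y.1 0 = T ∧ ∀ j, ρ' j (y.1 0) < r j y.1} ∪
                ⋃ j, Ψ' j '' {x | t j x.1 = Th j ∧ r j x.1 < Rg j (t j x.1) + 2}))
    let SeamFlatRestrict : Prop :=
      ∀ (𝓢 : Spacetime.{0} 4) (O : Set 𝓢.carrier) (U U' : TopologicalSpace.Opens E4) (hU : U' ≤ U)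
        (τ₀ τ₀' : ℝ) (Φ : U → 𝓢.carrier), τ₀ ≤ τ₀' →
        𝓢.IsLateChart (Minkowski.backgroundOn U) O τ₀ Φ →
        𝓢.IsLateChart (Minkowski.backgroundOn U') O τ₀' (Φ ∘ TopologicalSpace.Opens.inclusion hU) ∧
        (∀ y : U', mfderiv 𝓘(ℝ, E4) (𝓡 4) (Φ ∘ TopologicalSpace.Opens.inclusion hU) y =
          mfderiv 𝓘(ℝ, E4) (𝓡 4) Φ (TopologicalSpace.Opens.inclusion hU y)) ∧
        (∀ y : U', 𝓢.deviation (Minkowski.backgroundOn U') (Φ ∘ TopologicalSpace.Opens.inclusion hU) y =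
          𝓢.deviation (Minkowski.backgroundOn U) Φ (TopologicalSpace.Opens.inclusion hU y)) ∧
        (∀ (k : ℕ) (S : Set U'), supCkENorm (Subtype.val '' S) k
            (𝓢.deviationExtend (Minkowski.backgroundOn U') (Φ ∘ TopologicalSpace.Opens.inclusion hU)) =
          supCkENorm (Subtype.val '' S) k (𝓢.deviationExtend (Minkowski.backgroundOn U) Φ)) ∧
        (∀ (k : ℕ) (τ : ℝ), 𝓢.deviationCk (Minkowski.backgroundOn U') (Φ ∘ TopologicalSpace.Opens.inclusion hU) k τ ≤
          𝓢.deviationCk (Minkowski.backgroundOn U) Φ k τ)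
    let SeamClockRadii : Prop :=
      ∀ (N : ℕ) (Λ : Fin N → lorentzGroup) (c : Fin N → E4) (M a : Fin N → ℝ) (R₁ τ₁ : ℝ)
        (ρ' Rg : Fin N → ℝ → ℝ) (t r : Fin N → E4 → ℝ),
        (∀ j y, t j y = (boostedKerrBackground (Λ j) (c j) (M j) (a j)).time y) →
        (∀ j y, r j y = (boostedKerrBackground (Λ j) (c j) (M j) (a j)).radius y) →
        (∀ j, 0 < ((Λ j : E4 ≃L[ℝ] E4) (E4.basisVector 0)) 0) →
        (∀ i, Continuous (ρ' i) ∧ ∀ s, R₁ + 1 ≤ ρ' i s) →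
        (∀ i, Monotone (Rg i) ∧ Continuous (Rg i) ∧ Tendsto (fun s ↦ Rg i s / s) atTop (𝓝 0) ∧
          ∀ s, R₁ + 4 ≤ Rg i s) →
        (∀ j (y : E4), τ₁ ≤ y 0 → r j y ≤ ρ' j (y 0) → r j y + 3 ≤ Rg j (t j y)) →
        (∀ j j' (y : E4), j ≠ j' → τ₁ ≤ y 0 → r j y ≤ Rg j (t j y) + 2 → Rg j' (t j' y) + 2 < r j' y) →
        ∃ (s : Fin N → ℝ) (τ₀' : ℝ), τ₁ ≤ τ₀' ∧ (∀ i, 0 ≤ s i) ∧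
          (∀ i, Monotone (fun τ ↦ Rg i (τ + s i)) ∧ Continuous (fun τ ↦ Rg i (τ + s i)) ∧
            ∀ τ, R₁ + 4 ≤ Rg i (τ + s i) ∧ R₁ ≤ ρ' i τ) ∧
          (∀ j (y : E4), τ₁ ≤ t j y → r j y ≤ Rg j (t j y) + 2 → t j y - s j ≤ y 0) ∧
          (∀ j (y : E4), τ₀' ≤ y 0 → r j y ≤ ρ' j (y 0) → r j y + 2 ≤ Rg j (t j y - s j + s j)) ∧
          (∀ j (y : E4), τ₀' ≤ t j y - s j → r j y ≤ Rg j (t j y - s j + s j) + 2 → t j y - s j ≤ y 0) ∧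
          (∀ j j' (y : E4), j ≠ j' → (τ₀' ≤ y 0 ∨ τ₀' ≤ t j y - s j) →
            r j y ≤ Rg j (t j y - s j + s j) + 1 → Rg j' (t j' y - s j' + s j') + 1 < r j' y) ∧
          (∀ T : ℝ, ∃ Y : ℝ, ∀ j (y : E4), Y ≤ y 0 → r j y ≤ Rg j (t j y) + 2 → T ≤ t j y - s j)
    SeamClockRadii → SeamFlatRestrict →
    ∀ (X : Type) [TopologicalSpace X] [ChartedSpace E3 X] [IsManifold (𝓡 3) ∞ X] [ConnectedSpace X]
      (D : InitialDataSet (𝓡 3) X), D ∈ admissibleVacuumData X →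
      ∀ 𝒟 : VacuumCauchyDevelopment D, 𝒟.IsMaximal →
      ∀ (O : Set 𝒟.carrier) (d : FinalStateDecomposition 𝒟.toSpacetime O 4) (R₀ : ℝ),
        O = exteriorOf 𝒟.toCauchyDevelopment d.charted →
        HonestCore 𝒟.toSpacetime O 4 d R₀ → HonestFar 𝒟.toSpacetime O 4 d R₀ → d.N = 0 →
        NeckAtlas 𝒟.toSpacetime O d R₀ →
        ∃ (d₂ : FinalStateDecomposition 𝒟.toSpacetime O 2) (R : Fin d₂.N → ℝ → ℝ) (R₀' : ℝ),
          O = exteriorOf 𝒟.toCauchyDevelopment d₂.charted ∧ HonestCore 𝒟.toSpacetime O 2 d₂ R₀' ∧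
            Seamed 𝒟.toSpacetime O d₂ R R₀' := by
  intro HonestCore HonestFar Seamed NeckAtlas SeamFlatRestrict SeamClockRadii _ hSFR X _ _ _ _ D _
    𝒟 _ O d R₀ hO hc hf hN hA
  obtain ⟨-, -, -, hc4⟩ := hc
  obtain ⟨hf1, hf2, -⟩ := hf
  obtain ⟨R₁, τ₁, ρ', Rg, Ψ', -, hτ₁, -, -, -, -, -, -, -, -, -, -, -, -, -, hA13⟩ := hA
  haveI hE : IsEmpty (Fin d.N) := by rw [hN]; infer_instance
  -- the late starting time `T`: beyond `τ₁ + 1` and the flat `C⁴` slab deviation is `≤ 1/10`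
  obtain ⟨T₀, hT₀⟩ : ∃ T₀ : ℝ, ∀ τ, T₀ ≤ τ →
      𝒟.toSpacetime.deviationCk (Minkowski.backgroundOn d.flatDomain) d.flatChart 4 τ ≤ 10⁻¹ := by
    have h10 : (0 : ℝ≥0∞) < 10⁻¹ := by norm_num
    exact eventually_atTop.1 (d.tendsto_deviationCk_flat.eventually (ge_mem_nhds h10))
  set T : ℝ := max (τ₁ + 1) T₀ with hTdef
  have hTτ₁ : τ₁ < T := lt_of_lt_of_le (lt_add_one τ₁) (le_max_left _ _)
  have hTτ₀ : d.τ₀ < T := lt_of_le_of_lt hτ₁ hTτ₁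
  have hTT₀ : T₀ ≤ T := le_max_right _ _
  -- the flat chart is a late chart after `T` (rung SFR with `U' = U`)
  have hLC : 𝒟.toSpacetime.IsLateChart (Minkowski.backgroundOn d.flatDomain) O T d.flatChart := by
    have h := (hSFR 𝒟.toSpacetime O d.flatDomain d.flatDomain le_rfl d.τ₀ T d.flatChart hTτ₀.le
      d.isLateChart_flat).1
    exact h
  -- A13 at the threshold `T` (no holes): the covering clause of the restricted decomposition
  have hcov : O \ (d.flatChart '' (Minkowski.backgroundOn d.flatDomain).lateRegion T) ⊆
      𝒟.toSpacetime.metric.causalPast 𝒟.toSpacetime.timeOrientation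
        (d.flatChart '' (Minkowski.backgroundOn d.flatDomain).timeSlab T) := by
    have h := hA13 T (fun _ ↦ T) hTτ₁ (fun _ ↦ hTτ₁) (fun j ↦ (hE.false j).elim)
    rw [Set.iUnion_of_empty, Set.union_empty, Set.iUnion_of_empty, Set.union_empty] at h
    have e1 : {y : d.flatDomain | T < y.1 0 ∧ ∀ j : Fin d.N, ρ' j (y.1 0) < (d.background j).radius y.1} =
        (Minkowski.backgroundOn d.flatDomain).lateRegion T := by
      ext y; simp only [Set.mem_setOf_eq, IsEmpty.forall_iff, and_true]; rfl
    have e2 : {y : d.flatDomain | y.1 0 = T ∧ ∀ j : Fin d.N, ρ' j (y.1 0) < (d.background j).radius y.1} =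
        (Minkowski.backgroundOn d.flatDomain).timeSlab T := by
      ext y; simp only [Set.mem_setOf_eq, IsEmpty.forall_iff, and_true]; rfl
    rwa [e1, e2] at h
  -- the witness: the input restricted to `T`, no hole chart
  let d₂ : FinalStateDecomposition 𝒟.toSpacetime O 2 :=
    { N := 0
      mass := Fin.elim0
      spin := Fin.elim0
      mass_pos := fun i ↦ i.elim0
      abs_spin_le_mass := fun i ↦ i.elim0
      motion := Fin.elim0
      τ₀ := T
      chart := fun i ↦ i.elim0
      isLateChart := fun i ↦ i.elim0
      tendsto_truncDeviationCk := fun i ↦ i.elim0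
      exists_pairwise_disjoint := fun _ ↦ ⟨0, fun i ↦ i.elim0⟩
      excision := Fin.elim0
      tendsto_excision_div := fun i ↦ i.elim0
      flatDomain := d.flatDomain
      setOf_lt_excision_subset_flatDomain := fun x hx ↦
        d.setOf_lt_excision_subset_flatDomain ⟨hTτ₀.trans hx.1, fun i ↦ (hE.false i).elim⟩
      flatChart := d.flatChart
      isLateChart_flat := hLC
      tendsto_deviationCk_flat :=
        tendsto_of_tendsto_of_tendsto_of_le_of_le tendsto_const_nhds d.tendsto_deviationCk_flat
          (fun _ ↦ zero_le) fun _ ↦ supCkENorm_mono_right _ (by norm_num) _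
      diff_subset_causalPast := by
        rw [Set.iUnion_of_empty, Set.empty_union, Set.iUnion_of_empty, Set.empty_union]
        exact hcov }
  have hch₂ : d₂.charted = d.flatChart '' (Minkowski.backgroundOn d.flatDomain).lateRegion T := by
    rw [FinalStateDecomposition.charted, Set.iUnion_of_empty, Set.union_empty]; rfl
  have hch : d.charted = d.flatChart '' (Minkowski.backgroundOn d.flatDomain).lateRegion d.τ₀ := by
    rw [FinalStateDecomposition.charted, Set.iUnion_of_empty, Set.union_empty]; rfl
  refine ⟨d₂, fun i ↦ i.elim0, R₀, ?_, ?_, ?_⟩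
  · -- `O = exteriorOf 𝒟 d₂.charted`
    rw [hch₂]
    refine Set.Subset.antisymm ?_ ?_
    · intro p hp
      rw [hO, hch] at hp
      obtain ⟨hpJ, hpI⟩ := hp
      refine ⟨hpJ, ?_⟩
      -- `p ≪ Φ y` with `y` flat-late
      have hpI' : p ∈ 𝒟.toSpacetime.metric.chronologicalFuture 𝒟.toSpacetime.timeOrientation.reverse
          (d.flatChart '' (Minkowski.backgroundOn d.flatDomain).lateRegion d.τ₀) := hpI
      rw [LorentzianMetric.chronologicalFuture_eq_biUnion] at hpI'
      simp only [Set.mem_iUnion, exists_prop] at hpI'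
      obtain ⟨q, ⟨y, hy, rfl⟩, hpq⟩ := hpI'
      have hy' : d.τ₀ < y.1 0 := hy
      show p ∈ 𝒟.toSpacetime.metric.chronologicalFuture 𝒟.toSpacetime.timeOrientation.reverse
          (d.flatChart '' (Minkowski.backgroundOn d.flatDomain).lateRegion T)
      rw [LorentzianMetric.chronologicalFuture_eq_biUnion]
      simp only [Set.mem_iUnion, exists_prop]
      by_cases hyT : T < y.1 0
      · exact ⟨d.flatChart y, ⟨y, hyT, rfl⟩, hpq⟩
      · -- `Φ y ≤ Φ z` with `z⁰ = T + 1` (`HonestFar`(1)), then push-up `p ≪ Φ y ≤ Φ z`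
        have hyT' : y.1 0 < T + 1 := by linarith [not_lt.mp hyT]
        have h1 := hf1 (T + 1) (by linarith) ⟨y, ⟨hy', hyT'⟩, rfl⟩
        have h1' : d.flatChart y ∈ 𝒟.toSpacetime.metric.causalFuture
            𝒟.toSpacetime.timeOrientation.reverse
            (d.flatChart '' (Minkowski.backgroundOn d.flatDomain).timeSlab (T + 1)) := h1
        rw [LorentzianMetric.causalFuture_eq_biUnion] at h1'
        simp only [Set.mem_iUnion, exists_prop] at h1'
        obtain ⟨w, ⟨z, hz, rfl⟩, hqz⟩ := h1'
        have hz' : z.1 0 = T + 1 := hz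
        have hn1 : (1 : WithTop ℕ∞) ≤ ((⊤ : ℕ∞) : WithTop ℕ∞) := WithTop.coe_le_coe.mpr le_top
        exact ⟨d.flatChart z, ⟨z, show T < z.1 0 by rw [hz']; linarith, rfl⟩,
          LorentzianMetric.mem_chronologicalFuture_of_mem_causalFuture hn1 hqz hpq⟩
    · intro p hp
      rw [hO, hch]
      exact ⟨hp.1, LorentzianMetric.chronologicalFuture_mono
        (Set.image_mono ((Minkowski.backgroundOn d.flatDomain).lateRegion_mono hTτ₀.le)) hp.2⟩
  · -- `HonestCore d₂ R₀`: only the future orientation of the flat chart is not vacuous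
    exact ⟨fun i ↦ i.elim0, fun i ↦ i.elim0, fun i ↦ i.elim0, fun y hy ↦ hc4 y (hTτ₀.trans hy)⟩
  · -- `Seamed d₂ R R₀`: S3 (flat `C⁰` threshold) and S11 (closures) are not vacuous
    refine ⟨fun i ↦ i.elim0, fun i ↦ i.elim0, ?_, fun i ↦ i.elim0, fun i ↦ i.elim0, fun i ↦ i.elim0,
      fun _ _ j ↦ j.elim0, fun j ↦ j.elim0, fun j ↦ j.elim0, fun j ↦ j.elim0, ?_, fun j ↦ j.elim0⟩
    · exact stub_seamSurgery_flatLateSup 𝒟.toSpacetime d.flatDomain d.flatChart 4 T 10⁻¹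
        fun τ hτ ↦ hT₀ τ (hTT₀.trans hτ)
    · intro τ' hτ'
      haveI : IsEmpty (Fin d₂.N) := Fin.isEmpty'
      rw [Set.iUnion_of_empty, Set.union_empty]
      change T < τ' at hτ'
      show closure (d.flatChart '' {y | τ' ≤ y.1 0}) ⊆ d.flatChart '' {y | τ' ≤ y.1 0}
      have h := hf2 τ' (hTτ₀.trans hτ')
      have e : {y : d.flatDomain | τ' ≤ y.1 0 ∧ ∀ i : Fin d.N, d.excision i (y.1 0) + 1 ≤ (d.background i).radius y.1} =
          {y | τ' ≤ y.1 0} := by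
        ext y; simp only [Set.mem_setOf_eq, IsEmpty.forall_iff, and_true]
      rwa [e] at h

end Summit.FinalStateConjecture.FinalStateConjecture.Theorems.NecksCertifyTwoCap.Seam

end
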